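import Literature.MathematicalPhysics.PowerSystems.DroopSyncExponentialStability
import HarnessLib

/-!
# Power flow shaping by droop coefficients (Dörfler–Simpson-Porco–Bullo 2016, «Breaking the
# Hierarchy», §3.4 Definition 3 and Theorem 3.4): every γ-feasible injection setpoint is reached by the
# selection `D_i = β(P_i* − P_i^set)`, and conversely

Topic `Literature/MathematicalPhysics/PowerSystems` (LADDER-GRIDFUSION rung G3.b, frequency-droop lineage;
seat gridfusion-lit-2, g15).  Source: F. Dörfler, J. W. Simpson-Porco, F. Bullo, *Breaking the
Hierarchy: Distributed Control & Economic Optimality in Microgrids*, IEEE Trans. Control Netw. Syst. 3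
(2016) = arXiv:1401.1767 [DorflerSimpsonporcoBullo2014] (held text read on the page this session:
§3.2 Theorem 3.2 p0010 L13–L29, §3.4 Definition 3 and Theorem 3.4 p0010 L73–p0011 L31).  Built on the
tree's SPDB2013 files BY NAME: `DroopControlledInverters.lean` (the droop network `DroopNetwork`, the
shifted injections `P̃_i = P_i* − ω_avg D_i`, (Aux)-equilibria, edge lists / KCL flows / the arc
`Δ̄_G(γ)`, Theorem 2 for acyclic networks) and `DroopSyncExponentialStability.lean` (Theorem 2's
«locally exponentially stable», all-inverter networks).

THE PRINTED STATEMENTS (p0010 L73 – p0011 L31).  «Definition 3 (Feasible Power Injection Setpoint).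
Let `γ ∈ [0, π/2[`. A vector `P^set ∈ ℝⁿ` is a γ-feasible power injection setpoint if it satisfies
the following three properties: Power balance: `P^set ∈ 𝟙_n^⊥`; Load invariance: `P^set_i = P_i*` for
all loads `i ∈ V_L`; γ-feasibility: the associated branch power flows `ξ^set = B†P^set` are feasible,
that is, `‖𝒜⁻¹ξ^set‖_∞ ≤ sin(γ)`.»  «For simplicity, we omit the singular case where `ω_sync = 0`,
since in this case the droop coefficients offer no control over the steady-state inverter injections
`P_e,i(θ*) = P_i* − D_iω_sync`.»  «Theorem 3.4 (Power Flow Shaping). Consider the shifted control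
system (7). Assume `ω_sync ≠ 0`, let `P^set ∈ 𝟙_n^⊥`, and let `γ ∈ [0, π/2[`. The following
statements are equivalent: (i) Coefficient selection: there exists a selection of droop coefficients
`D_i`, `i ∈ V_I`, such that the steady-state injections satisfy `P_e(θ*) = P^set`, with
`[θ*] ⊂ Δ̄_G(γ)`; (ii) Feasibility: `P^set` is a γ-feasible power injection setpoint. If the equivalent
statements (i) and (ii) hold true, then the quantities `D_i` and `P^set_i` are related with arbitrary
`β ≠ 0` as `D_i = β(P_i* − P^set_i)`, `i ∈ V_I` (11). Moreover, `[θ*]` is locally exponentially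
stable if and only if `β(P_i* − P^set_i)` is nonnegative for all `i ∈ V_I`.»  PRINTED PROOF (p0011
L3–L15): (i) ⇒ (ii) by Theorem 3.2; (ii) ⇒ (i): with `D_i = β(P_i* − P^set_i)`,
`P_e,i(θ*) = P_i* − D_iω_sync = P_i* − β(P_i* − P^set_i)(1/β)·ΣP*/Σ_{V_I}(P* − P^set) = P^set_i`
«where we used `Σ_{V_I}P^set = −Σ_{V_L}P*`»; «the shifted system is stable iff all `D_i` are
nonnegative» by [JWSP-FD-FB:12u].

WHAT THIS FILE PROVES (0 named facts; acyclic networks as in Theorem 3.2 / the tree's Theorem 2).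
* §1 `withDc` (the same network with other droop coefficients; injections unchanged), the selection
  `shapingDc β P^set = β(P* − P^set)` (11), Definition 3 as `IsFeasibleSetpoint` (power balance, load
  invariance, a KCL flow `ξ` of `P^set` with `|ξ_ℓ| ≤ a_ℓ sin γ` — on an acyclic network THE flow
  `B†P^set`, `EdgeList.div_injective`); **`shiftedInjection_shaping`** (the printed computation:
  `ω_sync ≠ 0`, `β ≠ 0`, `P^set ∈ 𝟙^⊥` ⇒ the steady-state injections of the re-tuned network are
  `P^set`), `avgFrequency_shaping` (`ω_avg = 1/β`).
* §2 **`theorem_3_4_shaping`** ((ii) ⇒ (i), acyclic network): a γ-feasible `P^set` is reached — with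
  `D = β(P* − P^set)` there is an (Aux)-equilibrium `θ* ∈ Δ̄_G(γ)` whose injections are `P^set`;
  **`isFeasibleSetpoint_of_isAuxEquilibrium`** ((i) ⇒ (ii), any network represented by the edge list):
  the injections of an (Aux)-equilibrium in `Δ̄_G(γ)` of ANY coefficient selection form a γ-feasible
  setpoint; **`dc_eq_shaping_of_isAuxEquilibrium`** (the relation (11): a selection reaching `P^set`
  IS `β(P* − P^set)` with `β = 1/ω_sync`); **`theorem_3_4_powerFlowShaping`** ((i) ⇔ (ii) assembled).
* §3 the stability clause, «if» direction, all-inverter case: **`shaping_locallyExpStable`** — if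
  `β(P_i* − P^set_i) > 0` for every node then the reached synchronized solution is locally
  exponentially stable (the tree's Theorem 2 stability BY NAME).

THREE COLUMNS / NOT CLAIMED.  MODEL statements (the frequency-droop closed loop of SPDB2013 /
DSB2016 (7), lossless, fixed voltages).  The «only if» half of the stability clause (a negative
coefficient destabilises) and the mixed case `β(P* − P^set)_i = 0` at an inverter (that node becomes a
constant-power node of the model) are NOT typed; `γ`-feasibility is carried with an explicit KCL flow
(= `B†P^set` on acyclic networks by `EdgeList.div_injective`); angles are real lifts (the torus
manifold `[θ*]` = the lift modulo rotation).  Nothing here says a microgrid can be dispatched.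

## References

* F. Dörfler, J. W. Simpson-Porco, F. Bullo, *Breaking the Hierarchy: Distributed Control & Economic
  Optimality in Microgrids*, IEEE TCNS 3 (2016) 241–253 = arXiv:1401.1767, §3.4 Definition 3,
  Theorem 3.4 and proof (p0010 L73 – p0011 L31). [DorflerSimpsonporcoBullo2014]
* J. W. Simpson-Porco, F. Dörfler, F. Bullo, *Synchronization and power sharing for droop-controlled
  inverters in islanded microgrids*, Automatica 49 (2013), Theorem 2. [SimpsonporcoDorflerBullo2013]

AI-produced formalisation (LADDER-GRIDFUSION seat gridfusion-lit-2 g15, 2026-08-28).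
-/

noncomputable section

namespace Literature.MathematicalPhysics.PowerSystems

open Real Finset
open scoped BigOperators

namespace DroopNetwork

variable {n m : ℕ} (N : DroopNetwork n) (E : EdgeList n m)

/-! ## §1 Re-tuned coefficients, the selection (11), Definition 3, the steady-state injections -/

/-- The same network with droop coefficients `D` (set points, voltages, lines unchanged).
[cite: DorflerSimpsonporcoBullo2014, §3.4 Theorem 3.4 (i) («there exists a selection of droop coefficients `D_i`»)] -/
def withDc (D : Fin n → ℝ) : DroopNetwork n := { N with Dc := D }

/-- The re-tuned coefficients. [cite: DorflerSimpsonporcoBullo2014, §3.4 Theorem 3.4 (i)] -/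
@[simp] theorem withDc_Dc (D : Fin n → ℝ) : (N.withDc D).Dc = D := rfl

/-- Re-tuning keeps the set points `P*`. [cite: DorflerSimpsonporcoBullo2014, §3.4 Theorem 3.4 (i)] -/
@[simp] theorem withDc_Pstar (D : Fin n → ℝ) : (N.withDc D).Pstar = N.Pstar := rfl

/-- Re-tuning keeps the coupling weights `a_ij = E_iE_j|Y_ij|`. [cite: DorflerSimpsonporcoBullo2014, §3.1 eq. (2)] -/
@[simp] theorem withDc_a (D : Fin n → ℝ) : (N.withDc D).a = N.a := rfl

/-- Re-tuning the droop coefficients does not change the injections `P_e(θ)`.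
[cite: DorflerSimpsonporcoBullo2014, §3.1 eq. (2) (`P_e,i(θ)` depends on `E`, `B` only)] -/
@[simp] theorem injection_withDc (D : Fin n → ℝ) (θ : Fin n → ℝ) :
    (N.withDc D).injection θ = N.injection θ := rfl

/-- An edge list representing `N` represents every re-tuned network. [cite: DorflerSimpsonporcoBullo2014, §3.1 (the incidence / weight data do not involve `D`)] -/
theorem represents_withDc {N : DroopNetwork n} (hE : E.Represents N) (D : Fin n → ℝ) :
    E.Represents (N.withDc D) := hE

/-- **The selection (11)**: `D_i = β(P_i* − P_i^set)` (zero at a node with `P_i^set = P_i*`, in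
particular at the loads by load invariance). [cite: DorflerSimpsonporcoBullo2014, §3.4 Theorem 3.4 eq. (11)] -/
def shapingDc (β : ℝ) (Pset : Fin n → ℝ) : Fin n → ℝ := fun i => β * (N.Pstar i - Pset i)

/-- **Definition 3 (γ-feasible power injection setpoint)**, with the KCL flow explicit: power balance
`Σ_i P_i^set = 0`, load invariance `P_i^set = P_i*` at the load nodes (`D_i = 0`), and a vector of
branch flows `ξ` with `Bξ = P^set` (on an acyclic network necessarily `ξ = B†P^set`) satisfying
`|ξ_ℓ| ≤ a_ℓ sin γ` on every edge (`‖𝒜⁻¹ξ‖_∞ ≤ sin γ`).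
[cite: DorflerSimpsonporcoBullo2014, §3.4 Definition 3 (p0010 L80–L88)] -/
def IsFeasibleSetpoint (γ : ℝ) (Pset : Fin n → ℝ) : Prop :=
  (∑ i, Pset i = 0) ∧ (∀ i, N.IsLoadNode i → Pset i = N.Pstar i) ∧
    ∃ ξ : Fin m → ℝ, (∀ i, Pset i = E.div ξ i) ∧ ∀ ℓ, |ξ ℓ| ≤ E.w ℓ * Real.sin γ

variable {N E}

/-- The selection (11) sums to `βΣ_iP_i*` when `P^set ∈ 𝟙^⊥` («we used `Σ_{V_I}P^set = −Σ_{V_L}P*`»).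
[cite: DorflerSimpsonporcoBullo2014, proof of Theorem 3.4 (p0011 L13)] -/
theorem sum_shapingDc (β : ℝ) {Pset : Fin n → ℝ} (hbal : ∑ i, Pset i = 0) :
    ∑ i, N.shapingDc β Pset i = β * ∑ i, N.Pstar i := by
  simp only [shapingDc, mul_sub, Finset.sum_sub_distrib, ← Finset.mul_sum, hbal, mul_zero, sub_zero]

/-- With the selection (11), `ω_avg = ΣP*/ΣD = 1/β` (the «`= 1`» under-brace of the printed proof).
[cite: DorflerSimpsonporcoBullo2014, proof of Theorem 3.4 (p0011 L7–L12)] -/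
theorem avgFrequency_shaping {β : ℝ} (hβ : β ≠ 0) {Pset : Fin n → ℝ} (hbal : ∑ i, Pset i = 0)
    (hP : ∑ i, N.Pstar i ≠ 0) : (N.withDc (N.shapingDc β Pset)).avgFrequency = β⁻¹ := by
  rw [avgFrequency, withDc_Dc, withDc_Pstar, sum_shapingDc β hbal]
  field_simp

/-- **The printed computation**: with `D_i = β(P_i* − P_i^set)`, `β ≠ 0`, `P^set ∈ 𝟙^⊥` and
`ω_sync ≠ 0` (⟺ `Σ_iP_i* ≠ 0`), the steady-state injections of the re-tuned network are
`P_e,i(θ*) = P_i* − D_iω_sync = P_i^set`. [cite: DorflerSimpsonporcoBullo2014, proof of Theorem 3.4 («`P_e,i(θ*) = P̃_i = P_i* − D_iω_sync = … = P^set_i`», p0011 L7–L13)] -/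
theorem shiftedInjection_shaping {β : ℝ} (hβ : β ≠ 0) {Pset : Fin n → ℝ} (hbal : ∑ i, Pset i = 0)
    (hP : ∑ i, N.Pstar i ≠ 0) (i : Fin n) :
    (N.withDc (N.shapingDc β Pset)).shiftedInjection i = Pset i := by
  rw [shiftedInjection, avgFrequency_shaping hβ hbal hP, withDc_Dc, withDc_Pstar, shapingDc]
  field_simp
  ring

/-! ## §2 Theorem 3.4: (ii) ⇒ (i), (i) ⇒ (ii), the relation (11) -/

/-- `|arcsin x| ≤ γ` when `|x| ≤ sin γ`, `0 ≤ γ < π/2`. [folklore] -/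
private theorem abs_arcsin_le_of_abs_le_sin {x γ : ℝ} (hγ0 : 0 ≤ γ) (hγ : γ < Real.pi / 2)
    (hx : |x| ≤ Real.sin γ) : |Real.arcsin x| ≤ γ := by
  rw [abs_le] at hx ⊢
  constructor
  · have h := Real.arcsin_le_arcsin hx.1
    rw [← Real.sin_neg, Real.arcsin_sin (by linarith) (by linarith)] at h
    exact h
  · have h := Real.arcsin_le_arcsin hx.2
    rw [Real.arcsin_sin (by linarith) hγ.le] at h
    exact h

/-- **Theorem 3.4, (ii) ⇒ (i) (acyclic network)**: a γ-feasible setpoint is REACHED by the selection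
`D_i = β(P_i* − P_i^set)` — the re-tuned network has an (Aux)-equilibrium `θ* ∈ Δ̄_G(γ)` (hence a
synchronized solution, `isSolutionAt_of_isAuxEquilibrium`) whose injections are exactly `P^set`; the
selection vanishes at the load nodes.  Hypotheses: edge list representing `N`, acyclic, `a_ℓ > 0`,
`γ ∈ [0, π/2[`, `β ≠ 0`, `ω_sync ≠ 0` (`Σ_iP_i* ≠ 0`).
[cite: DorflerSimpsonporcoBullo2014, §3.4 Theorem 3.4 ((ii) ⇒ (i)) and its proof (p0011 L5–L13)] -/
theorem theorem_3_4_shaping (hE : E.Represents N) (hA : E.Acyclic) (hw : ∀ ℓ, 0 < E.w ℓ) {γ : ℝ}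
    (hγ0 : 0 ≤ γ) (hγ : γ < Real.pi / 2) {β : ℝ} (hβ : β ≠ 0) (hP : ∑ i, N.Pstar i ≠ 0)
    {Pset : Fin n → ℝ} (hF : N.IsFeasibleSetpoint E γ Pset) :
    (∀ i, N.IsLoadNode i → N.shapingDc β Pset i = 0) ∧
      ∃ θ : Fin n → ℝ, E.InArc γ θ ∧ (N.withDc (N.shapingDc β Pset)).IsAuxEquilibrium θ ∧
        ∀ i, N.injection θ i = Pset i := by
  obtain ⟨hbal, hload, ξ, hξ, hfeas⟩ := hF
  refine ⟨fun i hi => by rw [shapingDc, hload i hi, sub_self, mul_zero], ?_⟩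
  obtain ⟨θ, hθ⟩ := E.exists_diff_eq hA (fun ℓ => Real.arcsin (ξ ℓ / E.w ℓ))
  have hsinγ : Real.sin γ < 1 := by
    rw [← Real.sin_pi_div_two]
    exact Real.sin_lt_sin_of_lt_of_le_pi_div_two (by linarith) le_rfl hγ
  have hratio : ∀ ℓ, |ξ ℓ / E.w ℓ| ≤ Real.sin γ := fun ℓ => by
    rw [abs_div, abs_of_pos (hw ℓ), div_le_iff₀ (hw ℓ), mul_comm]
    exact hfeas ℓ
  have hratio1 : ∀ ℓ, -1 ≤ ξ ℓ / E.w ℓ ∧ ξ ℓ / E.w ℓ ≤ 1 := fun ℓ => by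
    have h := abs_le.1 ((hratio ℓ).trans hsinγ.le)
    exact ⟨h.1, h.2⟩
  have hKCL : (N.withDc (N.shapingDc β Pset)).IsKCLFlow E ξ := fun i => by
    rw [shiftedInjection_shaping hβ hbal hP]; exact hξ i
  have heq : (N.withDc (N.shapingDc β Pset)).IsAuxEquilibrium θ := by
    refine isAuxEquilibrium_of_kclFlow _ E (represents_withDc E hE _) hKCL (θ := θ) fun ℓ => ?_
    rw [hθ ℓ, Real.sin_arcsin (hratio1 ℓ).1 (hratio1 ℓ).2, mul_div_assoc',
      mul_div_cancel_left₀ _ (ne_of_gt (hw ℓ))]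
  refine ⟨θ, fun ℓ => ?_, heq, fun i => ?_⟩
  · rw [hθ ℓ]
    exact abs_arcsin_le_of_abs_le_sin hγ0 hγ (hratio ℓ)
  · have h := heq i
    rw [injection_withDc, shiftedInjection_shaping hβ hbal hP] at h
    exact h

/-- **Theorem 3.4, (i) ⇒ (ii)**: if SOME coefficient selection `D` has an (Aux)-equilibrium
`θ* ∈ Δ̄_G(γ)` (`γ ∈ [0, π/2]`), then its steady-state injections `P^set := P_e(θ*)` form a γ-feasible
setpoint: power balance (lossless network), load invariance (`P_e,i = P̃_i = P_i*` where `D_i = 0`),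
and the branch flows `a_ℓ sin(θ_i* − θ_j*)` are a KCL flow with `|ξ_ℓ| ≤ a_ℓ sin γ`.
[cite: DorflerSimpsonporcoBullo2014, §3.4 Theorem 3.4 ((i) ⇒ (ii)) and its proof («Theorem 3.2 shows that `P^set` is a γ-feasible injection setpoint», p0011 L3–L4)] -/
theorem isFeasibleSetpoint_of_isAuxEquilibrium (hE : E.Represents N) (hw : ∀ ℓ, 0 ≤ E.w ℓ)
    (hY : ∀ i j, N.Yabs i j = N.Yabs j i) {D : Fin n → ℝ} (hD : ∀ i, N.IsLoadNode i → D i = 0)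
    {γ : ℝ} (hγ : γ ≤ Real.pi / 2) {θ : Fin n → ℝ} (hθ : E.InArc γ θ)
    (heq : (N.withDc D).IsAuxEquilibrium θ) :
    N.IsFeasibleSetpoint E γ (N.injection θ) := by
  refine ⟨N.sum_injection_eq_zero hY θ, fun i hi => ?_, E.edgeFlow θ, fun i => ?_, fun ℓ => ?_⟩
  · have h := heq i
    rw [injection_withDc, shiftedInjection, withDc_Dc, withDc_Pstar, hD i hi, mul_zero, sub_zero] at h
    exact h
  · exact E.injection_eq_div_edgeFlow hE θ i
  · exact abs_edgeFlow_le E hw hγ hθ ℓ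

/-- **The relation (11)**: if a coefficient selection `D` (with `Σ_iD_i ≠ 0`) reaches the injections
`P^set` at an (Aux)-equilibrium and `ω_sync ≠ 0` (`Σ_iP_i* ≠ 0`), then `D_i = β(P_i* − P_i^set)` for
every node with `β = 1/ω_sync = Σ_iD_i/Σ_iP_i*`.
[cite: DorflerSimpsonporcoBullo2014, §3.4 Theorem 3.4 («the quantities `D_i` and `P_i^set` are related with arbitrary `β ≠ 0` as `D_i = β(P_i* − P_i^set)`»)] -/
theorem dc_eq_shaping_of_isAuxEquilibrium {D : Fin n → ℝ} (hDsum : ∑ i, D i ≠ 0)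
    (hP : ∑ i, N.Pstar i ≠ 0) {θ : Fin n → ℝ} (heq : (N.withDc D).IsAuxEquilibrium θ) (i : Fin n) :
    D i = N.shapingDc ((∑ j, D j) / ∑ j, N.Pstar j) (N.injection θ) i := by
  have h := heq i
  rw [injection_withDc, shiftedInjection, withDc_Dc, withDc_Pstar, avgFrequency, withDc_Dc,
    withDc_Pstar] at h
  rw [shapingDc, h]
  field_simp
  ring

/-- **Theorem 3.4 (Power Flow Shaping), (i) ⇔ (ii)** on an acyclic network represented by the edge
list (`a_ℓ > 0`, `|Y|` symmetric, `ω_sync ≠ 0`, `γ ∈ [0, π/2[`): there is a coefficient selection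
(zero at the load nodes) with an (Aux)-equilibrium in `Δ̄_G(γ)` whose steady-state injections are
`P^set` IF AND ONLY IF `P^set` is a γ-feasible setpoint.
[cite: DorflerSimpsonporcoBullo2014, §3.4 Theorem 3.4 (p0010 L95 – p0011 L2)] -/
theorem theorem_3_4_powerFlowShaping (hE : E.Represents N) (hA : E.Acyclic) (hw : ∀ ℓ, 0 < E.w ℓ)
    (hY : ∀ i j, N.Yabs i j = N.Yabs j i) {γ : ℝ} (hγ0 : 0 ≤ γ) (hγ : γ < Real.pi / 2)
    (hP : ∑ i, N.Pstar i ≠ 0) (Pset : Fin n → ℝ) :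
    (∃ D : Fin n → ℝ, (∀ i, N.IsLoadNode i → D i = 0) ∧
        ∃ θ : Fin n → ℝ, E.InArc γ θ ∧ (N.withDc D).IsAuxEquilibrium θ ∧
          ∀ i, N.injection θ i = Pset i) ↔
      N.IsFeasibleSetpoint E γ Pset := by
  constructor
  · rintro ⟨D, hD, θ, hθ, heq, hinj⟩
    have h := isFeasibleSetpoint_of_isAuxEquilibrium hE (fun ℓ => (hw ℓ).le) hY hD hγ.le hθ heq
    have hP' : N.injection θ = Pset := funext hinj
    rwa [hP'] at h
  · intro hF
    obtain ⟨hload, θ, hθ, heq, hinj⟩ := theorem_3_4_shaping hE hA hw hγ0 hγ one_ne_zero hP hF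
    exact ⟨N.shapingDc 1 Pset, hload, θ, hθ, heq, hinj⟩

/-! ## §3 The stability clause («if» direction, all-inverter case) -/

/-- **«`[θ*]` is locally exponentially stable if `β(P_i* − P_i^set)` is nonnegative»**, typed in the
strict / all-inverter case: if `β(P_i* − P_i^set) > 0` at every node of a network with symmetric `|Y|`
and connected coupling, the synchronized solution through an (Aux)-equilibrium `θ* ∈ Δ̄_G(γ)`,
`γ < π/2`, of the re-tuned network is locally exponentially stable (the tree's Theorem 2 stability BY
NAME: convergence at an exponential rate to the rotating synchronized solution selected by the
`D`-weighted mean of the initial angles).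
[cite: DorflerSimpsonporcoBullo2014, §3.4 Theorem 3.4 («Moreover, `[θ*]` is locally exponentially stable if and only if `β(P_i* − P^set_i)` is nonnegative»; proof: «the shifted system is stable if and only if all `D_i` are nonnegative», p0011 L15); SimpsonporcoDorflerBullo2013, Theorem 2] -/
theorem shaping_locallyExpStable (hE : E.Represents N) (hY : ∀ i j, N.Yabs i j = N.Yabs j i)
    (ha : ∀ i j, 0 ≤ N.a i j) (hconn : ClassicalModel.CouplingConnected N.a)
    {β : ℝ} {Pset : Fin n → ℝ} (hpos : ∀ i, 0 < β * (N.Pstar i - Pset i))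
    {γ : ℝ} (hγ : γ < Real.pi / 2) {θ₀ : Fin n → ℝ} (hθ : E.InArc γ θ₀)
    (heq : (N.withDc (N.shapingDc β Pset)).IsAuxEquilibrium θ₀) :
    ∃ ρ > 0, ∃ k > 0, ∃ lam > 0, ∀ θ : ℝ → Fin n → ℝ,
      (∀ t, (N.withDc (N.shapingDc β Pset)).IsSolutionAt θ t) → ‖θ 0 - θ₀‖ < ρ →
        ∀ t : ℝ, 0 ≤ t →
          ‖θ t - fun i => θ₀ i + N.shapingDc β Pset ⬝ᵥ (θ 0 - θ₀) / (∑ i, N.shapingDc β Pset i)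
              + (N.withDc (N.shapingDc β Pset)).avgFrequency * t‖
            ≤ k * ‖θ 0 - fun i => θ₀ i + N.shapingDc β Pset ⬝ᵥ (θ 0 - θ₀) / ∑ i, N.shapingDc β Pset i‖
              * Real.exp (-lam * t) := by
  have hD : ∀ i, 0 < (N.withDc (N.shapingDc β Pset)).Dc i := fun i => by
    rw [withDc_Dc, shapingDc]; exact hpos i
  have harc : ∀ i j, i ≠ j → 0 < (N.withDc (N.shapingDc β Pset)).a i j → |θ₀ i - θ₀ j| < Real.pi / 2 :=
    fun i j hij hpos' => (abs_sub_le_of_inArc E (represents_withDc E hE _) hθ hij hpos').trans_lt hγ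
  exact syncSolution_locally_expStable (N := N.withDc (N.shapingDc β Pset)) hY ha hconn hD heq harc

end DroopNetwork

end Literature.MathematicalPhysics.PowerSystems
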